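import Summits.HodgeConjecture.HodgeConjecture.Theorems.H413E2SWIdentityCloseTransport
import Literature.NumberTheory.Automorphic.AdelicVectorPlaceSplittingSchwartzBruhatSlices
import Literature.NumberTheory.Weil1965.AdelicFibreMeasures
import HarnessLib

/-!
# H413 · E-2 · SW2 (iii) — I-CLOSE: fibrewise proportionality from the split-place frame and the slice bounds (step (T3))

Cell `hodgecm-mathlib`, crux H413 (`stmt-HodgeConjecture-24833`), child line `Cruxes/H413/Lines/F0_E2SiegelWeilWeilRange.lean` ED. 8,
stub `stub_SW2iii_siegelWeil`, identity half; pen sheet `F0/P4/F0P2a-p08/SW2-ICLOSE-ASSEMBLY.v0` §2 (1)–(4), WEIGHTED form (F0P4-plan (g4)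
RULING «WEIGHTS» 2026-08-31T03:36:58Z).  KERNEL MATHEMATICS ONLY (no definition, no `sorry`); imports ★ (T2b)
`Theorems.H413E2SWIdentityCloseTransport`, ★ (TENS-v) `Automorphic.AdelicVectorPlaceSplittingSchwartzBruhatSlices` (B-p18), ★ R4
`Weil1965.AdelicFibreMeasures`.  HC_CM is proved only modulo the 7 printed citations until rung 0 closes; nothing here is about Hodge classes.

WHAT THIS FILE DOES.  It produces the `hfib` binder of the outer assembly (T1) (`Theorems/H413E2SWIdentityClose`) — for two positive
functionals `S₁, S₂` on `𝒮_ℝ(𝔸_F^ι)` (theta side, Eisenstein side) fibred along a continuous `h`, one `b ∈ F`, and every NONNEGATIVE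
compactly supported `Θ ∈ 𝒮_ℝ`:  `∫ Θ dμ_b(S₁) = κ₀ ∫ Θ dμ_b(S₂)` — from
* a SPLIT-PLACE FRAME at a finite place `v`: a homeomorphism `e : 𝔸_F^ι ≃ₜ (K^κ × K^κ) × Y`, `Y = trivialAt F ι v` (the vectors with trivial
  `v`-component), whose first coordinate is a homeomorphism `βv` of the `v`-component (`he1 : (e x).1 = βv (x_v)`) and whose second coordinate
  is the prime-to-`v` part (`he2 : (e x).2 = (placeSplitting⁻¹ x).2`) — A-p01's `Theorems/H413E2SWSplitPlaceFrame` over B-p04's `β_v`;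
* the three (T2a) hypotheses (finite on compact rectangles, `GL_κ(K)`-invariant rectangle masses, carried by `S_{b′} × Y`) for BOTH pushed
  fibre measures `e_* μ_b(S₁)`, `e_* μ_b(S₂)` — A-p08's ★-track generic `FibreMeasureSplitPlace.map_fibreMeasure_identityClose_hypotheses`;
* the DILATE BOUNDS for the slices `y ↦ Θ(placeSplitting (t, y))` of `Θ` — (BOUND-b) ∘ COEFF-b (F0P4-p08) ∘ (L-D-v);
by slicing `Θ` at `v` (★ B-p18 `exists_sum_indicator_mul_slice_real`: `Θ = Σ_t 𝟙_{t+U}(x_v) · Θ(placeSplitting(t, ·))`), reading the slices in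
the frame (`𝟙_{t+U}(x_v) = 𝟙_{βv(t+U)}((e x).1)`), and applying ★ (T2b) `integral_eq_smul_integral_of_slices`.

References: A. Weil, *Sur la formule de Siegel dans la théorie des groupes classiques*, Acta Math. 113 (1965), Chap. V n° 50 (39)–(40)
p. 74; Chap. VI n° 52 Théorème 5 pp. 76–77 [Weil1965].
-/

set_option autoImplicit false
-- the cell's `Summit.HodgeConjecture.HodgeConjecture.…` namespace repeats the summit name by design (D-0017 layout)
set_option linter.dupNamespace false

noncomputable section

open MeasureTheory Filter Topology Set NumberField IsDedekindDomain
open scoped NNReal ENNReal Matrix Pointwise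
open Literature.NumberTheory.Automorphic Literature.NumberTheory.Automorphic.AdelicVector
open Literature.NumberTheory.Weil1965 Literature.NumberTheory.Weil1965.SplitPlace
open Literature.NumberTheory.GaloisRepresentations.IsNonarchimedeanLocalField
open Summit.HodgeConjecture.HodgeConjecture.Cruxes.H413.E2SWIdentityCloseTransport

namespace Summit.HodgeConjecture.HodgeConjecture.Cruxes.H413.E2SWIdentityCloseFibre

/-- reading an indicator through an injective map: `𝟙_{f '' A}(f a) = 𝟙_A(a)`. [folklore] -/
theorem indicator_image_of_injective {α β : Type*} {f : α → β} (hf : Function.Injective f) (A : Set α) (a : α) :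
    (f '' A).indicator (fun _ => (1 : ℝ)) (f a) = A.indicator (fun _ => (1 : ℝ)) a := by
  by_cases ha : a ∈ A
  · rw [Set.indicator_of_mem (Set.mem_image_of_mem _ ha), Set.indicator_of_mem ha]
  · rw [Set.indicator_of_notMem (fun h' => ha (hf.mem_set_image.1 h')), Set.indicator_of_notMem ha]

variable (F : Type) [Field F] [NumberField F] (ι : Type) [Fintype ι]
  [MeasurableSpace (AdeleRing (𝓞 F) F)] [BorelSpace (AdeleRing (𝓞 F) F)]
  (S₁ S₂ : piSchwartzBruhatReal F ι →ₗ[ℝ] ℝ)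
  (hS₁ : ∀ Ψ : piSchwartzBruhatReal F ι, 0 ≤ (Ψ : (ι → AdeleRing (𝓞 F) F) → ℝ) → 0 ≤ S₁ Ψ)
  (hS₂ : ∀ Ψ : piSchwartzBruhatReal F ι, 0 ≤ (Ψ : (ι → AdeleRing (𝓞 F) F) → ℝ) → 0 ≤ S₂ Ψ)
  (h : (ι → AdeleRing (𝓞 F) F) → AdeleRing (𝓞 F) F) (b : F) (v : HeightOneSpectrum (𝓞 F))
  {K : Type*} [Field K] [ValuativeRel K] [TopologicalSpace K] [IsNonarchimedeanLocalField K]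
  [MeasurableSpace K] [BorelSpace K] [MeasurableSingletonClass K] (μK : Measure K) [μK.IsAddHaarMeasure]
  {κ : Type*} [Fintype κ] [Nonempty κ] [DecidableEq κ] (hκ : 2 ≤ Fintype.card κ) (b' : K) (κ₀ : ℝ≥0)
  (βv : (ι → v.adicCompletion F) ≃ₜ ((κ → K) × (κ → K)))
  (e : (ι → AdeleRing (𝓞 F) F) ≃ₜ (((κ → K) × (κ → K)) × trivialAt F ι v))
  (he1 : ∀ x, (e x).1 = βv (evalAt F ι v x))
  (he2 : ∀ x, (e x).2 = ((placeSplitting F ι v).symm x).2)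

include μK hκ he1 he2 in
/-- **FIBREWISE PROPORTIONALITY FROM THE SPLIT-PLACE FRAME (the `hfib` binder of (T1), one `b`, one nonnegative `Θ`).**
Binders: the two (T2a)-triples `H₁`, `H₂` for `e_* μ_b(S₁)`, `e_* μ_b(S₂)` (A-p08's `map_fibreMeasure_identityClose_hypotheses`, VERBATIM
shapes), the frame clauses `he1`, `he2`, and the dilate bounds `hbd` for the slices of `Θ` at `v` along some `‖s n‖ → ∞` with exponent
`γ < |κ| − 1` ((BOUND-b) ∘ COEFF-b).  Conclusion: `∫ Θ dμ_b(S₁) = κ₀ · ∫ Θ dμ_b(S₂)`.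
[cite: Weil1965, Chap. V n° 50, (39)–(40), p. 74] [cite: Weil1965, Chap. VI n° 52, Théorème 5, pp. 76–77] -/
theorem integral_fibreMeasure_eq_smul_of_splitPlaceFrame
    (H₁ : (∀ (L : Set ((κ → K) × (κ → K))) (B : Set (trivialAt F ι v)), IsCompact L → IsCompact B →
        ((fibreMeasure F ι S₁ hS₁ h b).map e) (L ×ˢ B) < ⊤) ∧
      (∀ (g : GL κ K) (A : Set ((κ → K) × (κ → K))) (B : Set (trivialAt F ι v)), MeasurableSet A → MeasurableSet B →
        ((fibreMeasure F ι S₁ hS₁ h b).map e)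
          (((fun z => (((g : Matrix κ κ K) *ᵥ z.1, ((g⁻¹ : GL κ K) : Matrix κ κ K)ᵀ *ᵥ z.2) : (κ → K) × (κ → K))) ⁻¹' A) ×ˢ B) =
        ((fibreMeasure F ι S₁ hS₁ h b).map e) (A ×ˢ B)) ∧
      ((fibreMeasure F ι S₁ hS₁ h b).map e) ({z : (κ → K) × (κ → K) | z.1 ⬝ᵥ z.2 = b' ∧ z.1 ≠ 0 ∧ z.2 ≠ 0}ᶜ ×ˢ
        (univ : Set (trivialAt F ι v))) = 0)
    (H₂ : (∀ (L : Set ((κ → K) × (κ → K))) (B : Set (trivialAt F ι v)), IsCompact L → IsCompact B →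
        ((fibreMeasure F ι S₂ hS₂ h b).map e) (L ×ˢ B) < ⊤) ∧
      (∀ (g : GL κ K) (A : Set ((κ → K) × (κ → K))) (B : Set (trivialAt F ι v)), MeasurableSet A → MeasurableSet B →
        ((fibreMeasure F ι S₂ hS₂ h b).map e)
          (((fun z => (((g : Matrix κ κ K) *ᵥ z.1, ((g⁻¹ : GL κ K) : Matrix κ κ K)ᵀ *ᵥ z.2) : (κ → K) × (κ → K))) ⁻¹' A) ×ˢ B) =
        ((fibreMeasure F ι S₂ hS₂ h b).map e) (A ×ˢ B)) ∧
      ((fibreMeasure F ι S₂ hS₂ h b).map e) ({z : (κ → K) × (κ → K) | z.1 ⬝ᵥ z.2 = b' ∧ z.1 ≠ 0 ∧ z.2 ≠ 0}ᶜ ×ˢ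
        (univ : Set (trivialAt F ι v))) = 0)
    (Θ : piSchwartzBruhatReal F ι) (hΘ0 : 0 ≤ (Θ : (ι → AdeleRing (𝓞 F) F) → ℝ))
    (hΘc : HasCompactSupport (Θ : (ι → AdeleRing (𝓞 F) F) → ℝ))
    (hbd : ∀ t : ι → v.adicCompletion F, ∃ (s : ℕ → K) (M γ : ℝ), (∀ n, s n ≠ 0) ∧
      Tendsto (fun n => (normAbs K (s n) : ℝ)) atTop atTop ∧ γ < (Fintype.card κ : ℝ) - 1 ∧
      ∀ n, |(∫⁻ z in {z : (κ → K) × (κ → K) | ((s n)⁻¹ • z.1, z.2) ∈ piPrimePowBall K κ 0 ×ˢ piPrimePowBall K κ 0} ×ˢ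
              (univ : Set (trivialAt F ι v)),
            ENNReal.ofReal ((Θ : (ι → AdeleRing (𝓞 F) F) → ℝ) (placeSplitting F ι v (t, z.2))) ∂((fibreMeasure F ι S₁ hS₁ h b).map e)).toReal -
          (κ₀ : ℝ) * (∫⁻ z in {z : (κ → K) × (κ → K) | ((s n)⁻¹ • z.1, z.2) ∈ piPrimePowBall K κ 0 ×ˢ piPrimePowBall K κ 0} ×ˢ
              (univ : Set (trivialAt F ι v)),
            ENNReal.ofReal ((Θ : (ι → AdeleRing (𝓞 F) F) → ℝ) (placeSplitting F ι v (t, z.2))) ∂((fibreMeasure F ι S₂ hS₂ h b).map e)).toReal|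
        ≤ M * (normAbs K (s n) : ℝ) ^ γ) :
    ∫ x, (Θ : (ι → AdeleRing (𝓞 F) F) → ℝ) x ∂(fibreMeasure F ι S₁ hS₁ h b) =
      (κ₀ : ℝ) * ∫ x, (Θ : (ι → AdeleRing (𝓞 F) F) → ℝ) x ∂(fibreMeasure F ι S₂ hS₂ h b) := by
  haveI : SecondCountableTopology K := secondCountableTopology_localField K
  haveI : T2Space K := (isLocalField K).toT2Space
  haveI := secondCountableTopology_adeleRing (K := F)
  haveI : BorelSpace (ι → AdeleRing (𝓞 F) F) := Pi.borelSpace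
  haveI : BorelSpace (κ → K) := Pi.borelSpace
  haveI : BorelSpace ((κ → K) × (κ → K)) := Prod.borelSpace
  haveI := secondCountableTopology_trivialAt (K := F) (ι := ι) (v := v)
  haveI : BorelSpace (((κ → K) × (κ → K)) × trivialAt F ι v) := Prod.borelSpace
  -- slice `Θ` at `v` (★ TENS-v)
  obtain ⟨U, T, -, hUc, -, -, -, hdec⟩ := exists_sum_indicator_mul_slice_real v Θ.2
  -- a bound for `Θ`
  obtain ⟨C, hC⟩ := (continuous_of_mem_piSchwartzBruhatReal Θ.2).bounded_above_of_compact_support hΘc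
  -- the frame identifies the two coercions `⇑e.toMeasurableEquiv = ⇑e`
  have hcoe : (⇑e.toMeasurableEquiv : (ι → AdeleRing (𝓞 F) F) → ((κ → K) × (κ → K)) × trivialAt F ι v) = ⇑e :=
    Homeomorph.toMeasurableEquiv_coe e
  refine integral_eq_smul_integral_of_slices μK hκ b' κ₀ (fibreMeasure F ι S₁ hS₁ h b) (fibreMeasure F ι S₂ hS₂ h b)
    e.toMeasurableEquiv ?_ ?_ ?_ ?_ ?_ ?_ T (fun t => βv '' (t +ᵥ (U : Set (ι → v.adicCompletion F))))
    (fun t y => (Θ : (ι → AdeleRing (𝓞 F) F) → ℝ) (placeSplitting F ι v (t, y)))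
    (fun t _ => ?_) (fun t _ => ?_) (fun t _ => ?_) (fun t _ => slice_nonneg hΘ0 t) (fun _ => C) (fun t _ y => ?_)
    (fun t _ => hasCompactSupport_slice hΘc t) (Θ : (ι → AdeleRing (𝓞 F) F) → ℝ) (fun x => ?_) (fun t _ => ?_)
  · rw [hcoe]; exact H₁.1
  · rw [hcoe]; exact H₂.1
  · rw [hcoe]; exact H₁.2.1
  · rw [hcoe]; exact H₂.2.1
  · rw [hcoe]; exact H₁.2.2
  · rw [hcoe]; exact H₂.2.2
  · -- `βv '' (t + U)` is compact, hence measurable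
    exact ((hUc.vadd t).image βv.continuous).isClosed.measurableSet
  · exact (hUc.vadd t).image βv.continuous
  · exact (continuous_slice (continuous_of_mem_piSchwartzBruhatReal Θ.2) t).measurable
  · have h1 : ‖(Θ : (ι → AdeleRing (𝓞 F) F) → ℝ) (placeSplitting F ι v (t, y))‖ ≤ C := hC _
    rw [Real.norm_eq_abs] at h1
    exact (le_abs_self _).trans h1
  · -- the slice decomposition, read in the frame
    rw [hdec x, hcoe, he1 x, he2 x]
    refine Finset.sum_congr rfl fun t _ => ?_
    rw [indicator_image_of_injective βv.injective]
  · rw [hcoe]; exact hbd t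

end Summit.HodgeConjecture.HodgeConjecture.Cruxes.H413.E2SWIdentityCloseFibre

end
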